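import Summits.HodgeConjecture.HodgeConjecture.Theorems.HodgeLocusCensusModelFamilySmoothArith

/-!
# Hodge-locus census — PROPOSITION S: every member of the model family is nonsingular (kernel theorem)

certified instances and evidence bearing on the general Hodge conjecture; no claim.

`model_family_nonsingular` (the record's form: lead record `og81/CODIM-ONE-SIGMA-g32.md` §1e, ENGINE B
`M1234-CHAR0-g29.md` ADDENDUM B2, referee reading R138; derivation `ENGINEB-g42.md`).  For `d ≥ 3`,
`c'` PAIRS `(uᵢ, vᵢ)`, `k'` COUPLES `(yⱼ, zⱼ)`, `q = Σⱼ yⱼ^{d-2}`, `σ = Σᵢ uᵢvᵢ` and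
`F = Σᵢ uᵢvᵢ(uᵢ^{d-2} + vᵢ^{d-2} + q) + Σⱼ zⱼ(yⱼ^{d-1} + zⱼ^{d-1})` (the model family
`X_{d;c',k'} ⊂ ℙ^{2c'+2k'-1}` of the codimension-one Σ-branch of the census) the partial derivatives
`F_{uᵢ} = vᵢ((d-1)uᵢ^{d-2} + vᵢ^{d-2} + q)`, `F_{vᵢ} = uᵢ(uᵢ^{d-2} + (d-1)vᵢ^{d-2} + q)`,
`F_{yⱼ} = yⱼ^{d-3}((d-2)σ + (d-1)yⱼzⱼ)`, `F_{zⱼ} = yⱼ^{d-1} + d·zⱼ^{d-1}` — the hypotheses, written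
out — vanish together only at the origin of `ℂ^{2c'+2k'}`: `X_{d;c',k'}` is NONSINGULAR for every
`d ≥ 3` and all `c'`, `k'` (Euler: `d·F = Σ x·F_x`, so `F = 0` is automatic).  `model_member_nonsingular`
is the same statement in the exponent `n = d - 2 ≥ 1` (negated-conjunction form); the record form follows
by rewriting `d = n + 2`.  Only the three arithmetic endings were kernel theorems so far
(`HodgeLocusCensusModelFamilySmoothArith`, imported); this def-free file adds the reduction.

Proof.  `σ = 0` forces every couple and pair to vanish.  If `σ ≠ 0` (`invariant_of_partials`): active
pairs have `uᵢⁿ = vᵢⁿ = -q/(n+2)`, active couples `(n+1)yⱼzⱼ = -nσ` and a common `yⱼ^{2(n+1)}`;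
rescaled by a reference pair and couple, `S = σ/(u₀v₀)` is a sum of zeros and `n`-th roots of unity,
`T = q/y₀ⁿ` a sum of zeros and `n`-th powers of `2(n+1)`-th roots of unity, and eliminating `u₀v₀`,
`y₀` gives the INVARIANT IDENTITY `n^{(n+1)n} S^{(n+1)n} T^{2(n+1)} = (-1)ⁿ(n+2)ⁿ⁺²(n+1)^{(n+1)n}`
(`= (-1)^d d^d (d-1)^{(d-1)(d-2)}`, left side `(d-2)^{(d-1)(d-2)} S^{(d-1)(d-2)} T^{2(d-1)}`).
Endings: `d ≥ 5` — `S`, `T` are algebraic integers, so `±(n+2)ⁿ⁺²(n+1)^{(n+1)n}/n^{(n+1)n} ∈ ℤ`,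
against `not_dvd_shift`; `d = 4` — `S ∈ ℤ`, `2T ∈ ℤ + ℤ√-3` with equal parities, the norm of
`(2ST)⁶ = 64·2916` yields an integer cube root of `2916` (`not_cube_2916_int`); `d = 3` — `S ∈ ℤ`,
`T ∈ ℤ[i]`, the norm of `S²T⁴ = -108` yields an integer square root of `108` (`not_sq_108_int`).
-/

set_option linter.dupNamespace false

namespace Summit.HodgeConjecture.HodgeConjecture.HodgeLocus.Census.ModelFamilySmoothAll

open Complex Summit.HodgeConjecture.HodgeConjecture.HodgeLocus.Census.ModelFamilySmooth

/-- A finite sum of complex numbers each `0` or a root of unity is an algebraic integer. -/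
theorem isIntegral_sum_of_pow_eq_one (s : Finset ℕ) (f : ℕ → ℂ)
    (h : ∀ i ∈ s, f i = 0 ∨ ∃ m : ℕ, 0 < m ∧ f i ^ m = 1) : IsIntegral ℤ (∑ i ∈ s, f i) := by
  refine IsIntegral.sum _ fun i hi => ?_
  rcases h i hi with h0 | ⟨m, hm, h1⟩
  · rw [h0]; exact isIntegral_zero
  · exact IsIntegral.of_pow hm (by rw [h1]; exact isIntegral_one)

/-- A rational number that is an algebraic integer inside `ℂ` is an integer. -/
theorem int_of_isIntegral_ratCast (r : ℚ) (h : IsIntegral ℤ (r : ℂ)) : ∃ m : ℤ, (m : ℚ) = r := by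
  have h1 : IsIntegral ℤ (algebraMap ℚ ℂ r) := by simpa using h
  rw [isIntegral_algebraMap_iff (algebraMap ℚ ℂ).injective] at h1
  obtain ⟨m, hm⟩ := (IsIntegrallyClosed.isIntegral_iff (R := ℤ) (K := ℚ)).mp h1
  exact ⟨m, by simpa using hm⟩

/-- ENDING `d ≥ 5` (`n ≥ 3`): the invariant identity with algebraic integers `S`, `T` makes the
rational number `(-1)ⁿ(n+2)ⁿ⁺²(n+1)^{(n+1)n}/n^{(n+1)n}` an integer, against `not_dvd_shift`. -/
theorem ending_ge_three (n : ℕ) (hn : 3 ≤ n) (S T : ℂ) (hS : IsIntegral ℤ S) (hT : IsIntegral ℤ T)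
    (key : (n : ℂ) ^ ((n + 1) * n) * S ^ ((n + 1) * n) * T ^ (2 * (n + 1)) =
      (-1) ^ n * ((n : ℂ) + 2) ^ (n + 2) * ((n : ℂ) + 1) ^ ((n + 1) * n)) : False := by
  have hn0 : (n : ℂ) ^ ((n + 1) * n) ≠ 0 := pow_ne_zero _ (by exact_mod_cast (show n ≠ 0 by omega))
  set r : ℚ := (-1) ^ n * ((n : ℚ) + 2) ^ (n + 2) * ((n : ℚ) + 1) ^ ((n + 1) * n) /
    (n : ℚ) ^ ((n + 1) * n) with hr
  have hA : S ^ ((n + 1) * n) * T ^ (2 * (n + 1)) = (r : ℂ) := by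
    rw [hr]; push_cast; field_simp; linear_combination key
  obtain ⟨m, hm⟩ := int_of_isIntegral_ratCast r (by rw [← hA]; exact (hS.pow _).mul (hT.pow _))
  have hnq : (n : ℚ) ^ ((n + 1) * n) ≠ 0 := pow_ne_zero _ (by exact_mod_cast (show n ≠ 0 by omega))
  have h1 : (m : ℚ) * (n : ℚ) ^ ((n + 1) * n) =
      (-1) ^ n * ((n : ℚ) + 2) ^ (n + 2) * ((n : ℚ) + 1) ^ ((n + 1) * n) := by
    rw [hm, hr]; field_simp
  have h2 : m * (n : ℤ) ^ ((n + 1) * n) =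
      (-1) ^ n * ((n : ℤ) + 2) ^ (n + 2) * ((n : ℤ) + 1) ^ ((n + 1) * n) := by exact_mod_cast h1
  have h3 : ((n ^ ((n + 1) * n) : ℕ) : ℤ) ∣
      (-1) ^ n * (((n + 2) ^ (n + 2) * (n + 1) ^ ((n + 1) * n) : ℕ) : ℤ) :=
    ⟨m, by push_cast; linear_combination (-1 : ℤ) * h2⟩
  have h4 := Int.natAbs_dvd_natAbs.mpr h3
  simp only [Int.natAbs_mul, Int.natAbs_pow, Int.natAbs_neg, Int.natAbs_one, one_pow, one_mul,
    Int.natAbs_natCast] at h4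
  exact not_dvd_shift hn h4

/-- Zeros and square roots of unity sum to an integer (pair sum at `d = 3, 4`). -/
theorem sum_intCast_of_sq (s : Finset ℕ) (f : ℕ → ℂ) (h : ∀ i ∈ s, f i = 0 ∨ f i ^ 2 = 1 ∨ f i = 1) :
    ∃ a : ℤ, (∑ i ∈ s, f i) = a := by
  refine Finset.sum_induction f (fun w => ∃ a : ℤ, w = a)
    (fun x y ⟨a, ha⟩ ⟨b, hb⟩ => ⟨a + b, by rw [ha, hb]; push_cast; ring⟩) ⟨0, by simp⟩ fun i hi => ?_
  rcases h i hi with h0 | h1 | h1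
  · exact ⟨0, by simp [h0]⟩
  · rcases sq_eq_one_iff.mp h1 with h2 | h2 <;> [exact ⟨1, by simp [h2]⟩; exact ⟨-1, by simp [h2]⟩]
  · exact ⟨1, by simp [h1]⟩

/-- Zeros and cube roots of unity: `2Σ = A + B√3·i`, `A ≡ B (mod 2)` (couple sum at `d = 4`). -/
theorem two_mul_sum_of_cube (s : Finset ℕ) (f : ℕ → ℂ) (h : ∀ i ∈ s, f i = 0 ∨ f i ^ 3 = 1) :
    ∃ A B : ℤ, Even (A - B) ∧ 2 * (∑ i ∈ s, f i) = A + B * (Real.sqrt 3 : ℝ) * I := by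
  rw [Finset.mul_sum]
  refine Finset.sum_induction (fun i => 2 * f i)
    (fun w => ∃ A B : ℤ, Even (A - B) ∧ w = A + B * (Real.sqrt 3 : ℝ) * I) ?_ ⟨0, 0, by simp, by simp⟩
    fun i hi => ?_
  · rintro x y ⟨A, B, hAB, rfl⟩ ⟨A', B', hAB', rfl⟩
    refine ⟨A + A', B + B', ?_, by push_cast; ring⟩
    rw [show A + A' - (B + B') = (A - B) + (A' - B') by ring]; exact hAB.add hAB'
  rcases h i hi with h0 | h1
  · exact ⟨0, 0, by simp, by simp [h0]⟩
  have h3 : ((Real.sqrt 3 : ℝ) : ℂ) ^ 2 = 3 := by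
    rw [← ofReal_pow, Real.sq_sqrt (by norm_num : (3:ℝ) ≥ 0)]; norm_num
  have hfac : (f i - 1) * (((2 * f i + 1) - (Real.sqrt 3 : ℝ) * I) *
      ((2 * f i + 1) + (Real.sqrt 3 : ℝ) * I)) = 0 := by
    have e1 : ((2 * f i + 1) - (Real.sqrt 3 : ℝ) * I) * ((2 * f i + 1) + (Real.sqrt 3 : ℝ) * I)
        = (2 * f i + 1) ^ 2 - ((Real.sqrt 3 : ℝ) : ℂ) ^ 2 * I ^ 2 := by ring
    rw [e1, h3, I_sq]
    linear_combination (4 : ℂ) * h1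
  rcases mul_eq_zero.mp hfac with h1 | h23
  · exact ⟨2, 0, ⟨1, by norm_num⟩, by push_cast; linear_combination (2 : ℂ) * h1⟩
  · rcases mul_eq_zero.mp h23 with h2 | h3
    · exact ⟨-1, 1, ⟨-1, by norm_num⟩, by push_cast; linear_combination h2⟩
    · exact ⟨-1, -1, ⟨0, by norm_num⟩, by push_cast; linear_combination h3⟩

/-- ENDING `d = 4` (`n = 2`): `S⁶T⁶ = 2916` is impossible for `S ∈ ℤ` and `T` a sum of zeros and
cube roots of unity (norm to `ℤ`, parity: `M'³ = 2916`, excluded by `not_cube_2916_int`). -/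
theorem ending_two (S T : ℂ) (hS : ∃ a : ℤ, S = a)
    (hT : ∃ A B : ℤ, Even (A - B) ∧ 2 * T = A + B * (Real.sqrt 3 : ℝ) * I)
    (key : S ^ 6 * T ^ 6 = 2916) : False := by
  obtain ⟨a, rfl⟩ := hS
  obtain ⟨A, B, hAB, hT⟩ := hT
  have hX : 2 * (a : ℂ) * T = ((a * A : ℤ) : ℝ) + ((a * B : ℤ) : ℝ) * (Real.sqrt 3 : ℝ) * I := by
    push_cast; linear_combination (a : ℂ) * hT
  have hX6 : (2 * (a : ℂ) * T) ^ 6 = ((186624 : ℝ) : ℂ) := by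
    rw [show (2 * (a : ℂ) * T) ^ 6 = 64 * ((a : ℂ) ^ 6 * T ^ 6) by ring, key]; norm_num
  have hN : Complex.normSq (2 * (a : ℂ) * T) = ((a * A : ℤ) : ℝ) ^ 2 + 3 * ((a * B : ℤ) : ℝ) ^ 2 := by
    rw [hX, show (((a * A : ℤ) : ℝ) : ℂ) + ((a * B : ℤ) : ℝ) * (Real.sqrt 3 : ℝ) * I
        = (((a * A : ℤ) : ℝ) : ℂ) + ((((a * B : ℤ) : ℝ) * Real.sqrt 3 : ℝ) : ℂ) * I by push_cast; ring,
      normSq_add_mul_I, mul_pow, Real.sq_sqrt (by norm_num : (3:ℝ) ≥ 0)]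
    ring
  have hM6 : (((a * A : ℤ) : ℝ) ^ 2 + 3 * ((a * B : ℤ) : ℝ) ^ 2) ^ 6 = (186624 : ℝ) ^ 2 := by
    rw [← hN, ← map_pow, hX6, normSq_ofReal]; ring
  obtain ⟨M, hM⟩ : ∃ M : ℤ, M = (a * A) ^ 2 + 3 * (a * B) ^ 2 := ⟨_, rfl⟩
  have hM0 : (0 : ℝ) ≤ (M : ℝ) := by rw [hM]; push_cast; positivity
  have h6 : ((M : ℝ) ^ 3) ^ 2 = (186624 : ℝ) ^ 2 := by rw [← pow_mul, hM]; exact_mod_cast hM6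
  have hM3 : (M : ℝ) ^ 3 = 186624 := (pow_left_inj₀ (by positivity) (by norm_num) two_ne_zero).mp h6
  have hM3Z : M ^ 3 = 186624 := by exact_mod_cast hM3
  obtain ⟨t, ht⟩ : Even (a * A - a * B) := by rw [← mul_sub]; exact hAB.mul_left a
  obtain ⟨M', rfl⟩ : (4 : ℤ) ∣ M :=
    ⟨(a * B) ^ 2 + t * (a * B) + t ^ 2, by rw [hM, show a * A = a * B + (t + t) by linarith]; ring⟩
  have h64 : (64 : ℤ) * M' ^ 3 = 64 * 2916 := by linear_combination hM3Z
  exact not_cube_2916_int M' (mul_left_cancel₀ (by norm_num) h64)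

/-- Zeros and fourth roots of unity sum to a Gaussian integer (couple sum at `d = 3`). -/
theorem sum_gaussInt (s : Finset ℕ) (f : ℕ → ℂ) (h : ∀ i ∈ s, f i = 0 ∨ f i ^ 4 = 1) :
    ∃ A B : ℤ, (∑ i ∈ s, f i) = A + B * I := by
  refine Finset.sum_induction f (fun w => ∃ A B : ℤ, w = A + B * I) ?_ ⟨0, 0, by simp⟩ fun i hi => ?_
  · rintro x y ⟨A, B, rfl⟩ ⟨A', B', rfl⟩
    exact ⟨A + A', B + B', by push_cast; ring⟩
  rcases h i hi with h0 | h1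
  · exact ⟨0, 0, by simp [h0]⟩
  have hfac : ((f i - 1) * (f i + 1)) * ((f i - I) * (f i + I)) = 0 := by
    rw [show (f i - I) * (f i + I) = f i ^ 2 - I ^ 2 by ring, I_sq]
    linear_combination h1
  rcases mul_eq_zero.mp hfac with h12 | h34
  · rcases mul_eq_zero.mp h12 with h1 | h2
    · exact ⟨1, 0, by push_cast; linear_combination h1⟩
    · exact ⟨-1, 0, by push_cast; linear_combination h2⟩
  · rcases mul_eq_zero.mp h34 with h3 | h4
    · exact ⟨0, 1, by push_cast; linear_combination h3⟩
    · exact ⟨0, -1, by push_cast; linear_combination h4⟩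

/-- ENDING `d = 3` (`n = 1`): `S²T⁴ = -108` is impossible for `S ∈ ℤ`, `T ∈ ℤ[i]` (norm to `ℤ`:
`(S·N(T))² = 108`, excluded by `not_sq_108_int`). -/
theorem ending_one (S T : ℂ) (hS : ∃ a : ℤ, S = a) (hT : ∃ A B : ℤ, T = A + B * I)
    (key : S ^ 2 * T ^ 4 = -108) : False := by
  obtain ⟨a, rfl⟩ := hS
  obtain ⟨A, B, rfl⟩ := hT
  have hN : Complex.normSq (((a : ℤ) : ℂ) ^ 2 * ((A : ℂ) + (B : ℂ) * I) ^ 4)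
      = ((a : ℝ) ^ 2 * ((A : ℝ) ^ 2 + (B : ℝ) ^ 2) ^ 2) ^ 2 := by
    rw [map_mul, map_pow, map_pow, show ((a : ℤ) : ℂ) = ((a : ℝ) : ℂ) by norm_cast, normSq_ofReal,
      show ((A : ℤ) : ℂ) + ((B : ℤ) : ℂ) * I = ((A : ℝ) : ℂ) + ((B : ℝ) : ℂ) * I by norm_cast,
      normSq_add_mul_I]
    ring
  have h2 : ((a : ℝ) ^ 2 * ((A : ℝ) ^ 2 + (B : ℝ) ^ 2) ^ 2) ^ 2 = (108 : ℝ) ^ 2 := by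
    rw [← hN, key, show (-108 : ℂ) = ((-108 : ℝ) : ℂ) by norm_num, normSq_ofReal]; norm_num
  have h3 : (a : ℝ) ^ 2 * ((A : ℝ) ^ 2 + (B : ℝ) ^ 2) ^ 2 = 108 :=
    (pow_left_inj₀ (by positivity) (by norm_num) two_ne_zero).mp h2
  have h4 : ((a * (A ^ 2 + B ^ 2) : ℤ) : ℝ) ^ 2 = 108 := by push_cast; linear_combination h3
  exact not_sq_108_int (a * (A ^ 2 + B ^ 2)) (by exact_mod_cast h4)

/-- THE REDUCTION (lead record §1e Steps 1–2; ENGINE B ADDENDUM B2).  At a common zero of the four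
families of partials with pair sum `σ = Σ uᵢvᵢ ≠ 0`, pick an active pair `(u₀, v₀)` and a couple with
`y₀ ≠ 0`; the rescaled sums `S = σ/(u₀v₀)`, `T = q/y₀ⁿ` are sums of terms that are `0` or roots of
unity (`sⁿ = 1`, resp. `t = ξⁿ` with `ξ^{2(n+1)} = 1`), and eliminating `u₀v₀`, `y₀` between
`q² = (n+2)²(u₀v₀)ⁿ` and `(n+1)ⁿ⁺¹y₀^{2(n+1)} = (-1)ⁿ(n+2)nⁿ⁺¹σⁿ⁺¹` gives the INVARIANT IDENTITY
`n^{(n+1)n} S^{(n+1)n} T^{2(n+1)} = (-1)ⁿ (n+2)ⁿ⁺² (n+1)^{(n+1)n}` (`n = d - 2 ≥ 1`). -/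
theorem invariant_of_partials (n : ℕ) (hn : 1 ≤ n) (c k : ℕ) (u v y z : ℕ → ℂ)
    (Hu : ∀ i < c, v i * (((n : ℂ) + 1) * u i ^ n + v i ^ n + ∑ j ∈ Finset.range k, y j ^ n) = 0)
    (Hv : ∀ i < c, u i * (u i ^ n + ((n : ℂ) + 1) * v i ^ n + ∑ j ∈ Finset.range k, y j ^ n) = 0)
    (Hy : ∀ j < k, y j ^ (n - 1) *
      ((n : ℂ) * (∑ i ∈ Finset.range c, u i * v i) + ((n : ℂ) + 1) * y j * z j) = 0)
    (Hz : ∀ j < k, y j ^ (n + 1) + ((n : ℂ) + 2) * z j ^ (n + 1) = 0)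
    (hs : (∑ i ∈ Finset.range c, u i * v i) ≠ 0) :
    ∃ s t : ℕ → ℂ, (∀ i ∈ Finset.range c, s i = 0 ∨ s i ^ n = 1) ∧
      (∀ j ∈ Finset.range k, t j = 0 ∨ ∃ ξ : ℂ, ξ ^ (2 * (n + 1)) = 1 ∧ t j = ξ ^ n) ∧
      (n : ℂ) ^ ((n + 1) * n) * (∑ i ∈ Finset.range c, s i) ^ ((n + 1) * n) *
          (∑ j ∈ Finset.range k, t j) ^ (2 * (n + 1)) =
        (-1) ^ n * ((n : ℂ) + 2) ^ (n + 2) * ((n : ℂ) + 1) ^ ((n + 1) * n) := by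
  set q := ∑ j ∈ Finset.range k, y j ^ n with hq
  set σ := ∑ i ∈ Finset.range c, u i * v i with hσ
  have hn0 : n ≠ 0 := by omega
  have hnC : (n : ℂ) ≠ 0 := by exact_mod_cast hn0
  have hn2 : ((n : ℂ) + 2) ≠ 0 := by exact_mod_cast (show (n + 2 : ℕ) ≠ 0 by omega)
  -- active pairs `uᵢvᵢ ≠ 0`: `uᵢⁿ = vᵢⁿ` and `(n+2)uᵢⁿ + q = 0`
  have act : ∀ i < c, u i ≠ 0 → v i ≠ 0 → u i ^ n = v i ^ n ∧ ((n : ℂ) + 2) * u i ^ n + q = 0 := by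
    intro i hi hu0 hv0
    have B1 := (mul_eq_zero.mp (Hu i hi)).resolve_left hv0
    have B2 := (mul_eq_zero.mp (Hv i hi)).resolve_left hu0
    have h3 : (n : ℂ) * (u i ^ n - v i ^ n) = 0 := by linear_combination B1 - B2
    have h4 : u i ^ n = v i ^ n := sub_eq_zero.mp ((mul_eq_zero.mp h3).resolve_left hnC)
    exact ⟨h4, by linear_combination B1 + h4⟩
  -- a reference active pair `(u₀, v₀)` (as `σ ≠ 0`), `q ≠ 0`, and a reference couple `y₀ ≠ 0`
  obtain ⟨i₀, hi₀, huv₀⟩ : ∃ i₀ ∈ Finset.range c, u i₀ * v i₀ ≠ 0 := by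
    by_contra hcon; push Not at hcon; exact hs (Finset.sum_eq_zero hcon)
  have hu₀ : u i₀ ≠ 0 := left_ne_zero_of_mul huv₀
  have hv₀ : v i₀ ≠ 0 := right_ne_zero_of_mul huv₀
  obtain ⟨hρ, hρq⟩ := act i₀ (Finset.mem_range.mp hi₀) hu₀ hv₀
  have hq0 : q ≠ 0 := by
    intro hq0; rw [hq0, add_zero] at hρq
    exact hu₀ ((pow_eq_zero_iff hn0).mp ((mul_eq_zero.mp hρq).resolve_left hn2))
  obtain ⟨j₀, hj₀, hy₀⟩ : ∃ j₀ ∈ Finset.range k, y j₀ ≠ 0 := by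
    by_contra hcon
    push Not at hcon
    exact hq0 (Finset.sum_eq_zero fun j hj => by rw [hcon j hj, zero_pow hn0])
  have hj₀' := Finset.mem_range.mp hj₀
  -- active couples `yⱼ ≠ 0`: `(n+1)ⁿ⁺¹ yⱼ^{2(n+1)} = -(n+2)(-nσ)ⁿ⁺¹`
  have cpl : ∀ j < k, y j ≠ 0 →
      ((n : ℂ) + 1) ^ (n + 1) * y j ^ (2 * (n + 1)) = -((n : ℂ) + 2) * (-((n : ℂ) * σ)) ^ (n + 1) := by
    intro j hj hyj
    have hb := (mul_eq_zero.mp (Hy j hj)).resolve_left (pow_ne_zero _ hyj)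
    have ht : ((n : ℂ) + 1) * y j * z j = -((n : ℂ) * σ) := by linear_combination hb
    have h1 : ((n : ℂ) + 1) ^ (n + 1) * y j ^ (n + 1) * z j ^ (n + 1) = (-((n : ℂ) * σ)) ^ (n + 1) := by
      rw [← mul_pow, ← mul_pow, ht]
    calc ((n : ℂ) + 1) ^ (n + 1) * y j ^ (2 * (n + 1))
        = ((n : ℂ) + 1) ^ (n + 1) * y j ^ (n + 1) * y j ^ (n + 1) := by rw [two_mul, pow_add]; ring
      _ = -((n : ℂ) + 2) * (((n : ℂ) + 1) ^ (n + 1) * y j ^ (n + 1) * z j ^ (n + 1)) := by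
          linear_combination ((n : ℂ) + 1) ^ (n + 1) * y j ^ (n + 1) * Hz j hj
      _ = -((n : ℂ) + 2) * (-((n : ℂ) * σ)) ^ (n + 1) := by rw [h1]
  refine ⟨fun i => u i * v i / (u i₀ * v i₀), fun j => (y j / y j₀) ^ n, fun i hi => ?_,
    fun j hj => ?_, ?_⟩
  · -- pair terms are `0` or satisfy `sⁿ = 1`
    dsimp only
    by_cases hu0 : u i = 0
    · left; rw [hu0, zero_mul, zero_div]
    by_cases hv0 : v i = 0
    · left; rw [hv0, mul_zero, zero_div]
    right
    obtain ⟨hρi, hρqi⟩ := act i (Finset.mem_range.mp hi) hu0 hv0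
    have h1 : u i ^ n = u i₀ ^ n := by
      have e : ((n : ℂ) + 2) * (u i ^ n - u i₀ ^ n) = 0 := by linear_combination hρqi - hρq
      exact sub_eq_zero.mp ((mul_eq_zero.mp e).resolve_left hn2)
    rw [div_pow, mul_pow, mul_pow, ← hρi, ← hρ, h1]
    exact div_self (mul_ne_zero (pow_ne_zero _ hu₀) (pow_ne_zero _ hu₀))
  · -- couple terms are `0` or `ξⁿ` with `ξ^{2(n+1)} = 1`
    dsimp only
    by_cases hyj : y j = 0
    · left; rw [hyj, zero_div, zero_pow hn0]
    refine Or.inr ⟨y j / y j₀, ?_, rfl⟩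
    have h3 : ((n : ℂ) + 1) ^ (n + 1) * (y j ^ (2 * (n + 1)) - y j₀ ^ (2 * (n + 1))) = 0 := by
      rw [mul_sub, cpl j (Finset.mem_range.mp hj) hyj, cpl j₀ hj₀' hy₀, sub_self]
    have hn1 : ((n : ℂ) + 1) ^ (n + 1) ≠ 0 := pow_ne_zero _ (by exact_mod_cast (by omega : n + 1 ≠ 0))
    rw [div_pow, sub_eq_zero.mp ((mul_eq_zero.mp h3).resolve_left hn1)]
    exact div_self (pow_ne_zero _ hy₀)
  · -- the invariant identity
    dsimp only
    have hS : (∑ i ∈ Finset.range c, u i * v i / (u i₀ * v i₀)) = σ / (u i₀ * v i₀) := by rw [hσ, Finset.sum_div]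
    have hT : (∑ j ∈ Finset.range k, (y j / y j₀) ^ n) = q / y j₀ ^ n := by
      rw [hq, Finset.sum_div]
      exact Finset.sum_congr rfl fun j _ => by rw [div_pow]
    rw [hS, hT]
    have R1 : q ^ 2 = ((n : ℂ) + 2) ^ 2 * (u i₀ * v i₀) ^ n := by
      linear_combination (q - ((n : ℂ) + 2) * u i₀ ^ n) * hρq + ((n : ℂ) + 2) ^ 2 * u i₀ ^ n * hρ
    have R2 : ((n : ℂ) + 1) ^ (n + 1) * y j₀ ^ (2 * (n + 1)) =
        (-1) ^ n * ((n : ℂ) + 2) * (n : ℂ) ^ (n + 1) * σ ^ (n + 1) := by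
      rw [cpl j₀ hj₀' hy₀, neg_pow, mul_pow]; ring
    have hsign : ((-1 : ℂ) ^ n) ^ n = (-1) ^ n := by
      rcases Nat.even_or_odd n with he | ho <;> [rw [he.neg_one_pow, one_pow]; rw [ho.neg_one_pow, ho.neg_one_pow]]
    have hsq : ((-1 : ℂ) ^ n) ^ 2 = 1 := by rw [← pow_mul, mul_comm, pow_mul]; norm_num
    have hden : (u i₀ * v i₀) ^ ((n + 1) * n) * (y j₀ ^ n) ^ (2 * (n + 1)) ≠ 0 :=
      mul_ne_zero (pow_ne_zero _ (mul_ne_zero hu₀ hv₀)) (pow_ne_zero _ (pow_ne_zero _ hy₀))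
    -- make `n + 1`, `n + 2` atoms for `ring`; raise (R1) to the power `n + 1`, (R2) to the power `n`
    generalize hN1 : ((n : ℂ) + 1) = N₁ at R2 ⊢
    generalize hN2 : ((n : ℂ) + 2) = N₂ at R1 R2 ⊢
    have E1 : (q ^ 2) ^ (n + 1) = (N₂ ^ 2 * (u i₀ * v i₀) ^ n) ^ (n + 1) := by rw [R1]
    have E2 : (N₁ ^ (n + 1) * y j₀ ^ (2 * (n + 1))) ^ n =
        (-1) ^ n * N₂ ^ n * ((n : ℂ) ^ (n + 1)) ^ n * (σ ^ (n + 1)) ^ n := by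
      rw [R2, mul_pow, mul_pow, mul_pow, hsign]
    have main : (n : ℂ) ^ ((n + 1) * n) * σ ^ ((n + 1) * n) * q ^ (2 * (n + 1)) =
        (-1) ^ n * N₂ ^ (n + 2) * N₁ ^ ((n + 1) * n) *
          ((u i₀ * v i₀) ^ ((n + 1) * n) * (y j₀ ^ n) ^ (2 * (n + 1))) := by
      linear_combination (n : ℂ) ^ ((n + 1) * n) * σ ^ ((n + 1) * n) * E1
        + (-((-1 : ℂ) ^ n * N₂ ^ (n + 2) * (u i₀ * v i₀) ^ ((n + 1) * n))) * E2
        + (-((n : ℂ) ^ ((n + 1) * n) * σ ^ ((n + 1) * n) * N₂ ^ (2 * (n + 1)) *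
            (u i₀ * v i₀) ^ ((n + 1) * n))) * hsq
    rw [show (n : ℂ) ^ ((n + 1) * n) * (σ / (u i₀ * v i₀)) ^ ((n + 1) * n) * (q / y j₀ ^ n) ^ (2 * (n + 1))
        = ((n : ℂ) ^ ((n + 1) * n) * σ ^ ((n + 1) * n) * q ^ (2 * (n + 1))) /
          ((u i₀ * v i₀) ^ ((n + 1) * n) * (y j₀ ^ n) ^ (2 * (n + 1))) by rw [div_pow, div_pow]; ring,
      main, mul_div_cancel_right₀ _ hden]

/-- PROPOSITION S in the exponent `n = d - 2 ≥ 1` (negated-conjunction form; `c` pairs, `k` couples):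
the partials `∂F/∂uᵢ = vᵢ((n+1)uᵢⁿ + vᵢⁿ + q)`, `∂F/∂vᵢ = uᵢ(uᵢⁿ + (n+1)vᵢⁿ + q)`,
`∂F/∂yⱼ = yⱼⁿ⁻¹(nσ + (n+1)yⱼzⱼ)`, `∂F/∂zⱼ = yⱼⁿ⁺¹ + (n+2)zⱼⁿ⁺¹` of
`F = Σᵢ uᵢvᵢ(uᵢⁿ + vᵢⁿ + q) + Σⱼ zⱼ(yⱼⁿ⁺¹ + zⱼⁿ⁺¹)`, `q = Σⱼ yⱼⁿ`, `σ = Σᵢ uᵢvᵢ` (`i < c`, `j < k`)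
have no common zero except the origin. -/
theorem model_member_nonsingular (n : ℕ) (hn : 1 ≤ n) (c k : ℕ) (u v y z : ℕ → ℂ)
    (hne : ¬ ((∀ i < c, u i = 0 ∧ v i = 0) ∧ ∀ j < k, y j = 0 ∧ z j = 0)) :
    ¬ ((∀ i < c, v i * (((n : ℂ) + 1) * u i ^ n + v i ^ n + ∑ j ∈ Finset.range k, y j ^ n) = 0) ∧
       (∀ i < c, u i * (u i ^ n + ((n : ℂ) + 1) * v i ^ n + ∑ j ∈ Finset.range k, y j ^ n) = 0) ∧
       (∀ j < k, y j ^ (n - 1) *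
          ((n : ℂ) * (∑ i ∈ Finset.range c, u i * v i) + ((n : ℂ) + 1) * y j * z j) = 0) ∧
       (∀ j < k, y j ^ (n + 1) + ((n : ℂ) + 2) * z j ^ (n + 1) = 0)) := by
  rintro ⟨Hu, Hv, Hy, Hz⟩
  have hn0 : n ≠ 0 := by omega
  have hnC : (n : ℂ) ≠ 0 := by exact_mod_cast hn0
  have hn1 : ((n : ℂ) + 1) ≠ 0 := by exact_mod_cast (show (n + 1 : ℕ) ≠ 0 by omega)
  have hn2 : ((n : ℂ) + 2) ≠ 0 := by exact_mod_cast (show (n + 2 : ℕ) ≠ 0 by omega)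
  -- couples: `yⱼ = 0 ↔ zⱼ = 0`
  have cz : ∀ j < k, (y j = 0 ↔ z j = 0) := fun j hj => by
    have h := Hz j hj
    constructor <;> intro h0 <;> rw [h0, zero_pow (by omega)] at h
    · exact (pow_eq_zero_iff (by omega : n + 1 ≠ 0)).mp ((mul_eq_zero.mp (by simpa using h)).resolve_left hn2)
    · exact (pow_eq_zero_iff (by omega : n + 1 ≠ 0)).mp (by simpa using h)
  by_cases hs : (∑ i ∈ Finset.range c, u i * v i) = 0
  · -- `σ = 0`: every couple and every pair vanishes, so the point is the origin
    have hy0 : ∀ j < k, y j = 0 := fun j hj => by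
      by_contra hyj
      have hb := (mul_eq_zero.mp (Hy j hj)).resolve_left (pow_ne_zero _ hyj)
      rw [hs, mul_zero, zero_add] at hb
      exact mul_ne_zero (mul_ne_zero hn1 hyj) (fun h => hyj ((cz j hj).mpr h)) hb
    have hq0 : (∑ j ∈ Finset.range k, y j ^ n) = 0 :=
      Finset.sum_eq_zero fun j hj => by rw [hy0 j (Finset.mem_range.mp hj), zero_pow hn0]
    refine hne ⟨fun i hi => ?_, fun j hj => ⟨hy0 j hj, (cz j hj).mp (hy0 j hj)⟩⟩
    have h1 := Hu i hi
    have h2 := Hv i hi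
    rw [hq0, add_zero] at h1 h2
    rcases mul_eq_zero.mp h1 with hv0 | B1 <;> rcases mul_eq_zero.mp h2 with hu0 | B2
    · exact ⟨hu0, hv0⟩
    · rw [hv0, zero_pow hn0, mul_zero, add_zero] at B2
      exact ⟨(pow_eq_zero_iff hn0).mp B2, hv0⟩
    · rw [hu0, zero_pow hn0, mul_zero, zero_add] at B1
      exact ⟨hu0, (pow_eq_zero_iff hn0).mp B1⟩
    · have h3 : ((n : ℂ) * ((n : ℂ) + 2)) * v i ^ n = 0 := by
        linear_combination ((n : ℂ) + 1) * B2 - B1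
      have hv0 : v i = 0 :=
        (pow_eq_zero_iff hn0).mp ((mul_eq_zero.mp h3).resolve_left (mul_ne_zero hnC hn2))
      rw [hv0, zero_pow hn0, mul_zero, add_zero] at B2
      exact ⟨(pow_eq_zero_iff hn0).mp B2, hv0⟩
  · -- `σ ≠ 0`: the invariant identity, then the arithmetic ending of the degree
    obtain ⟨s, t, hs', ht', key⟩ := invariant_of_partials n hn c k u v y z Hu Hv Hy Hz hs
    rcases (show n = 1 ∨ n = 2 ∨ 3 ≤ n by omega) with rfl | rfl | hn3
    · -- `d = 3`
      refine ending_one _ _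
        (sum_intCast_of_sq _ _ fun i hi => (hs' i hi).imp_right fun h => Or.inr (by simpa using h))
        (sum_gaussInt _ _ fun j hj => (ht' j hj).imp_right fun ⟨ξ, hξ, h⟩ => by
          rw [h, pow_one]; simpa using hξ) ?_
      norm_num at key
      linear_combination key
    · -- `d = 4`
      refine ending_two _ _ (sum_intCast_of_sq _ _ fun i hi => (hs' i hi).imp_right Or.inl)
        (two_mul_sum_of_cube _ _ fun j hj => (ht' j hj).imp_right fun ⟨ξ, hξ, h⟩ => by
          rw [h, ← pow_mul]; simpa using hξ) ?_
      norm_num at key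
      linear_combination key / 64
    · -- `d ≥ 5`
      exact ending_ge_three n hn3 _ _
        (isIntegral_sum_of_pow_eq_one _ _ fun i hi => (hs' i hi).imp_right fun h => ⟨n, by omega, h⟩)
        (isIntegral_sum_of_pow_eq_one _ _ fun j hj => (ht' j hj).imp_right fun ⟨ξ, hξ, h⟩ =>
          ⟨2 * (n + 1), by omega, by rw [h, ← pow_mul, mul_comm, pow_mul, hξ, one_pow]⟩) key

/-- **PROPOSITION S** (record `og81/CODIM-ONE-SIGMA-g32.md` §1e, its own form).  `d ≥ 3`, `c'` pairs
`(uᵢ, vᵢ)`, `k'` couples `(yⱼ, zⱼ)`, `q = Σ_{j<k'} yⱼ^{d-2}`, `σ = Σ_{i<c'} uᵢvᵢ`,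
`F = Σ_{i<c'} uᵢvᵢ(uᵢ^{d-2} + vᵢ^{d-2} + q) + Σ_{j<k'} zⱼ(yⱼ^{d-1} + zⱼ^{d-1})`.  Hypotheses: the
`2c' + 2k'` partials `F_{uᵢ} = vᵢ((d-1)uᵢ^{d-2} + vᵢ^{d-2} + q)`, `F_{vᵢ} = uᵢ(uᵢ^{d-2} + (d-1)vᵢ^{d-2} + q)`,
`F_{yⱼ} = yⱼ^{d-3}((d-2)σ + (d-1)yⱼzⱼ)`, `F_{zⱼ} = yⱼ^{d-1} + d·zⱼ^{d-1}` vanish.  Conclusion: the point is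
the origin of `ℂ^{2c'+2k'}` — every member `X_{d;c',k'} = V(F) ⊂ ℙ^{2c'+2k'-1}` of the model family is
NONSINGULAR (all `d ≥ 3`, all `c'`, `k'`, the cells with `c' = 0` or `k' = 0` included). -/
theorem model_family_nonsingular (d c' k' : ℕ) (hd : 3 ≤ d) (u v y z : ℕ → ℂ)
    (Hu : ∀ i < c', v i * (((d : ℂ) - 1) * u i ^ (d - 2) + v i ^ (d - 2) +
      ∑ j ∈ Finset.range k', y j ^ (d - 2)) = 0)
    (Hv : ∀ i < c', u i * (u i ^ (d - 2) + ((d : ℂ) - 1) * v i ^ (d - 2) +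
      ∑ j ∈ Finset.range k', y j ^ (d - 2)) = 0)
    (Hy : ∀ j < k', y j ^ (d - 3) *
      (((d : ℂ) - 2) * (∑ i ∈ Finset.range c', u i * v i) + ((d : ℂ) - 1) * y j * z j) = 0)
    (Hz : ∀ j < k', y j ^ (d - 1) + (d : ℂ) * z j ^ (d - 1) = 0) :
    (∀ i < c', u i = 0 ∧ v i = 0) ∧ (∀ j < k', y j = 0 ∧ z j = 0) := by
  obtain ⟨n, rfl⟩ : ∃ n, d = n + 2 := ⟨d - 2, by omega⟩
  have e1 : n + 2 - 1 = n + 1 := by omega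
  have e2 : n + 2 - 2 = n := by omega
  have e3 : n + 2 - 3 = n - 1 := by omega
  have c1 : (n : ℂ) + 2 - 1 = (n : ℂ) + 1 := by ring
  have c2 : (n : ℂ) + 2 - 2 = (n : ℂ) := by ring
  simp only [e1, e2, e3, Nat.cast_add, Nat.cast_ofNat, c1, c2] at Hu Hv Hy Hz
  by_contra hne
  exact model_member_nonsingular n (by omega) c' k' u v y z hne ⟨Hu, Hv, Hy, Hz⟩

end Summit.HodgeConjecture.HodgeConjecture.HodgeLocus.Census.ModelFamilySmoothAll
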